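import Literature.Topology.FourManifolds.EntranceDiscMatching
import Literature.Topology.FourManifolds.SpherePositions

/-!
# The sphere diffeomorphism of a couple; structure conjugacy of two one-level Morse data

Topic `Literature/Topology/FourManifolds` (support of `stmt-SmoothPoincare4-15190`; conclusion
of the structure-conjugacy chain `CoupleConjugacy.lean` ← … ← `EntranceDiscMatching.lean`).
Everything here is **proved**.

* `Diffeomorph.invProd` / `invProd_apply_of_mem` — composing the inverses of finitely many diffeomorphisms
  each equal to the identity off its own member of a pairwise disjoint family of sets: on `V i`
  the product acts as the `i`-th factor;
* `BasinCouple.SaddleData.exists_germCond` — for couple saddle data on an **oriented** compact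
  `3`-manifold with boundary (index-`1` boxes, equal bottom and saddle values) there are a twist
  of the boxes of `B` by planar reflections, a sphere diffeomorphism `φ` and `δ₀ > 0` with the
  germ condition `GermCond` of `CoupleConjugacy.lean` (positions `SpherePositions.lean`, signs
  `CoupleSignSelection.lean`, germs `EntranceDiscMatching.lean` composed with disjoint supports);
* `BasinCouple.SaddleData.diffeoExtends_of_orientation` — **structure conjugacy**: a
  diffeomorphism `G` of `∂W` which extends to a diffeomorphism of `W` and maps the trace of each
  saddle `s` of `A` onto the trace of `σ s` of `B`.

## References

* J. Milnor, *Lectures on the h-cobordism theorem* (1965), Thm. 3.4, Def. 3.9, proof of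
  Thm. 3.12/3.13. [MilnorHCobordism1965]
* M. W. Hirsch, *Differential Topology* (1976), Ch. 4 §4; Ch. 8 §3, Thm. 3.1. [HirschDT1976]
-/

open scoped Manifold ContDiff Topology
open Set Function Filter Metric Module

noncomputable section

namespace Literature.Topology.FourManifolds

/-! ### Products of diffeomorphisms with disjoint supports -/

section ListProd

variable {E H : Type*} [NormedAddCommGroup E] [NormedSpace ℝ E] [TopologicalSpace H] {J : ModelWithCorners ℝ E H}
  {N : Type*} [TopologicalSpace N] [ChartedSpace H N] {ι : Type*}

/-- The product `H_{i₁}⁻¹ ∘ ⋯` of the inverses of a list of diffeomorphisms (the head acts last). [folklore] -/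
def Diffeomorph.invProd (H : ι → N ≃ₘ⟮J, J⟯ N) : List ι → N ≃ₘ⟮J, J⟯ N
  | [] => Diffeomorph.refl J N ∞
  | j :: l => (Diffeomorph.invProd H l).trans (H j).symm

/-- `invProd` on `j :: l`. [folklore] -/
theorem Diffeomorph.invProd_cons_apply (H : ι → N ≃ₘ⟮J, J⟯ N) (j : ι) (l : List ι) (p : N) :
    Diffeomorph.invProd H (j :: l) p = (H j).symm (Diffeomorph.invProd H l p) := rfl

/-- A bijection equal to the identity off `V` maps `V` into itself, and so does its inverse. [folklore] -/
theorem Diffeomorph.symm_apply_mem_of_forall {Hd : N ≃ₘ⟮J, J⟯ N} {V : Set N} (hV : ∀ x ∉ V, Hd x = x) {p : N} (hp : p ∈ V) :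
    Hd.symm p ∈ V := by
  by_contra h
  have h1 : Hd (Hd.symm p) = Hd.symm p := hV _ h
  rw [Hd.apply_symm_apply] at h1
  exact h (h1 ▸ hp)

/-- A bijection equal to the identity off `V` maps `V` into itself. [folklore] -/
theorem Diffeomorph.apply_mem_of_forall {Hd : N ≃ₘ⟮J, J⟯ N} {V : Set N} (hV : ∀ x ∉ V, Hd x = x) {p : N} (hp : p ∈ V) :
    Hd p ∈ V := by
  by_contra h
  have h1 : Hd (Hd p) = Hd p := hV _ h
  have h2 : Hd p = p := Hd.injective h1
  rw [h2] at h
  exact h hp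

/-- The inverse of a bijection equal to the identity off `V` is the identity off `V`. [folklore] -/
theorem Diffeomorph.symm_apply_eq_of_forall {Hd : N ≃ₘ⟮J, J⟯ N} {V : Set N} (hV : ∀ x ∉ V, Hd x = x) {p : N} (hp : p ∉ V) :
    Hd.symm p = p := by
  have h := hV p hp
  conv_lhs => rw [← h]
  exact Hd.symm_apply_apply p

/-- **On `V i` the product of the inverses acts as `(H i)⁻¹`** when the `V j` are pairwise disjoint,
each `H j` is the identity off `V j`, and `i` occurs in the (duplicate-free) list. [folklore] -/
theorem Diffeomorph.invProd_apply_of_mem [DecidableEq ι] (H : ι → N ≃ₘ⟮J, J⟯ N) (V : ι → Set N)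
    (hid : ∀ j, ∀ x ∉ V j, H j x = x) (hdisj : ∀ j j', j ≠ j' → Disjoint (V j) (V j')) :
    ∀ (l : List ι), l.Nodup → ∀ {i : ι} {p : N}, p ∈ V i →
      Diffeomorph.invProd H l p = if i ∈ l then (H i).symm p else p := by
  intro l
  induction l with
  | nil => intro _ i p _; simp [Diffeomorph.invProd]
  | cons j l ih =>
    intro hnd i p hp
    rw [List.nodup_cons] at hnd
    rw [Diffeomorph.invProd_cons_apply, ih hnd.2 hp]
    by_cases hil : i ∈ l
    · have hji : j ≠ i := fun h => hnd.1 (h ▸ hil)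
      rw [if_pos hil, if_pos (List.mem_cons_of_mem j hil)]
      have hq : (H i).symm p ∈ V i := Diffeomorph.symm_apply_mem_of_forall (hid i) hp
      exact Diffeomorph.symm_apply_eq_of_forall (hid j) (fun h => (hdisj j i hji).le_bot ⟨h, hq⟩)
    · rw [if_neg hil]
      by_cases hji : j = i
      · subst hji
        simp
      · have hni : i ∉ j :: l := by
          rw [List.mem_cons]; rintro (h | h)
          · exact hji h.symm
          · exact hil h
        rw [if_neg hni]
        exact Diffeomorph.symm_apply_eq_of_forall (hid j) (fun h => (hdisj j i hji).le_bot ⟨h, hp⟩)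

end ListProd

/-! ### The sphere diffeomorphism of a couple -/

namespace BasinCouple.SaddleData

open Cobordism FourManifolds.Flow TracePolar

attribute [local instance] fact_finrank_euclideanSpace_succ

universe u

variable {W : Type u} [TopologicalSpace W] [T2Space W] [SecondCountableTopology W]
  [CompactSpace W] [ChartedSpace (EuclideanHalfSpace (2 + 1)) W] [IsManifold (𝓡∂ (2 + 1)) ∞ W]
  {gA gB : W → ℝ} {ξA ξB : Π x : W, TangentSpace (𝓡∂ (2 + 1)) x} {C : BasinCouple gA gB ξA ξB}
  (Q : C.SaddleData)

/-- Local notation for the model plane and space. -/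
local notation "E2" => EuclideanSpace ℝ (Fin 2)
local notation "E3" => EuclideanSpace ℝ (Fin 3)

variable {Q} (hkA : ∀ s, (Q.QA.DA s).k = 1) (hkB : ∀ s', (Q.QB.DA s').k = 1)
  (h₀ : gB C.B.p₀ = gA C.A.p₀) (hc : Q.QB.c = Q.QA.c)

include hkA hkB h₀ hc in
/-- **The germ condition is realised after a twist of the boxes of `B`** (oriented `W`). [cite: MilnorHCobordism1965, proof of Thm. 3.12/3.13] [cite: HirschDT1976, Ch. 8 §3, Thm. 3.1] -/
theorem exists_germCond (o : SmoothOrientation (𝓡∂ (2 + 1)) W) :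
    ∃ (bf : SaddlePt 2 gB → Bool) (φ : Metric.sphere (0 : E3) 1 ≃ₘ⟮𝓡 2, 𝓡 2⟯ Metric.sphere (0 : E3) 1) (δ₀ : ℝ),
      0 < δ₀ ∧ δ₀ ≤ Q.QA.ε ^ 2 ∧ (Q.twistQB bf).GermCond φ δ₀ := by
  classical
  haveI : Finite (SaddlePt 2 gA) := C.A.finite_saddlePt
  -- positions and signs
  obtain ⟨φ₀, hφ0⟩ := Q.exists_sphereDiffeo_coreDir hkA hkB
  set bf := Q.signFlag φ₀ with hbf
  set Q' : C.SaddleData := Q.twistQB bf with hQ'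
  have hkA' : ∀ s, (Q'.QA.DA s).k = 1 := hkA
  have hkB' : ∀ s', (Q'.QB.DA s').k = 1 := fun s' => hkB s'
  have hc' : Q'.QB.c = Q'.QA.c := hc
  have hφ0' : ∀ (s : SaddlePt 2 gA) (b : Bool), (φ₀ (unitVec (Q'.QA.coreDir s b)) : E3) = C.A.rad⁻¹ • Q'.QB.coreDir (Q'.σ s) b :=
    fun s b => Q.hφ0_twistQB hφ0 bf s b
  have hpos : ∀ (s : SaddlePt 2 gA) (b : Bool), 0 < Q'.tDet φ₀ s b := fun s b => Q.tDet_twistQB_pos hkA hkB h₀ hc hφ0 o s b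
  -- the centres and their separation
  let ι := SaddlePt 2 gA × Bool
  let cB : ι → Metric.sphere (0 : E3) 1 := fun i => unitVec (Q'.QB.coreDir (Q'.σ i.1) i.2)
  have hcB : Injective cB := by
    intro i j h
    have h1 := Q'.QB.unitVec_coreDir_injective hkB' (a₁ := (Q'.σ i.1, i.2)) (a₂ := (Q'.σ j.1, j.2)) h
    simp only [Prod.mk.injEq] at h1
    obtain ⟨h2, h3⟩ := h1
    exact Prod.ext (Q'.σ.injective h2) h3
  -- Voronoi cells of the centres: open, pairwise disjoint neighbourhoods
  let V : ι → Set (Metric.sphere (0 : E3) 1) := fun i => ⋂ j : ι, {p | j ≠ i → dist p (cB i) < dist p (cB j)}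
  have hVopen : ∀ i, IsOpen (V i) := fun i => by
    refine isOpen_iInter_of_finite fun j => ?_
    by_cases hji : j = i
    · have : {p : Metric.sphere (0 : E3) 1 | j ≠ i → dist p (cB i) < dist p (cB j)} = univ :=
        eq_univ_of_forall fun p h => absurd hji h
      rw [this]; exact isOpen_univ
    · have : {p : Metric.sphere (0 : E3) 1 | j ≠ i → dist p (cB i) < dist p (cB j)} = {p | dist p (cB i) < dist p (cB j)} :=
        Set.ext fun p => ⟨fun h => h hji, fun h _ => h⟩
      rw [this]
      exact isOpen_lt (continuous_id.dist continuous_const) (continuous_id.dist continuous_const)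
  have hcV : ∀ i, cB i ∈ V i := fun i => mem_iInter.2 fun j hji => by
    rw [dist_self]; exact dist_pos.2 fun h => hji (hcB h.symm)
  have hVdisj : ∀ i j, i ≠ j → Disjoint (V i) (V j) := fun i j hij =>
    disjoint_left.2 fun p hpi hpj => by
      have h1 : dist p (cB i) < dist p (cB j) := mem_iInter.1 hpi j (Ne.symm hij)
      have h2 : dist p (cB j) < dist p (cB i) := mem_iInter.1 hpj i hij
      exact lt_asymm h1 h2
  -- the radius: small enough for all ends at once
  have hpt : ∀ i : ι, ContinuousAt (fun z : E2 => unitVec (Q'.QB.entDir (Q'.σ i.1) i.2 z)) 0 := fun i => by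
    have hy0 : ‖(0 : E2)‖ ^ 2 < Q'.QB.ε ^ 2 := by rw [norm_zero]; simpa using Q'.QB.sq_pos
    have hne : Q'.QB.entDir (Q'.σ i.1) i.2 0 ≠ 0 := by
      rw [← norm_ne_zero_iff, Q'.QB.norm_entDir (hkB' _) hy0]; exact C.B.rad_pos.ne'
    exact ((contMDiffOn_unitVec _ hne).contMDiffAt (isOpen_ne.mem_nhds hne)).continuousAt.comp
      (Q'.QB.contMDiffAt_entDir (hkB' _) hy0).continuousAt
  have hev1 : ∀ i : ι, ∀ᶠ r in 𝓝[>] (0 : ℝ), ∀ z : E2, ‖z‖ < r → unitVec (Q'.QB.entDir (Q'.σ i.1) i.2 z) ∈ V i := by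
    intro i
    have hmem : (fun z : E2 => unitVec (Q'.QB.entDir (Q'.σ i.1) i.2 z)) ⁻¹' V i ∈ 𝓝 (0 : E2) :=
      (hpt i).preimage_mem_nhds ((hVopen i).mem_nhds (by
        show unitVec (Q'.QB.entDir (Q'.σ i.1) i.2 0) ∈ V i
        exact hcV i))
    obtain ⟨η, hη0, hη⟩ := Metric.mem_nhds_iff.1 hmem
    have hI : Ioo (0 : ℝ) η ∈ 𝓝[>] (0 : ℝ) := Ioo_mem_nhdsGT hη0
    filter_upwards [hI] with r hr z hz
    exact hη (mem_ball_zero_iff.2 (hz.trans hr.2))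
  have hev2 : ∀ᶠ r in 𝓝[>] (0 : ℝ), r ^ 2 < Q'.QA.ε ^ 2 := by
    have hI : Ioo (0 : ℝ) Q'.QA.ε ∈ 𝓝[>] (0 : ℝ) := Ioo_mem_nhdsGT Q'.QA.ε_pos
    filter_upwards [hI] with r hr
    nlinarith [hr.1, hr.2]
  have hev0 : ∀ᶠ r in 𝓝[>] (0 : ℝ), 0 < r := self_mem_nhdsWithin
  obtain ⟨r, hr1, hrε, hr⟩ := ((eventually_all.2 hev1).and (hev2.and hev0)).exists
  -- the matching diffeomorphisms
  have hrange : ∀ i : ι, range (Q'.QB.ue r (Q'.σ i.1) i.2) ⊆ V i := by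
    rintro i _ ⟨y, rfl⟩
    rw [BasinPair.SaddleData.ue_apply]
    exact hr1 i _ (BasinPair.SaddleData.norm_shrinkB_lt hr y)
  have hmatch : ∀ i : ι, ∃ Hd : Metric.sphere (0 : E3) 1 ≃ₘ⟮𝓡 2, 𝓡 2⟯ Metric.sphere (0 : E3) 1,
      Diffeomorph.IsCompactlyDiffeotopicToIdIn (V i) Hd ∧
        ∃ ρ > (0 : ℝ), ∀ y : E2, ‖y‖ ≤ ρ → Hd (Q'.QB.ue r (Q'.σ i.1) i.2 y) = φ₀ (Q'.QA.ue r i.1 i.2 y) := fun i =>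
    exists_matching_diffeo (Q := Q') hkA' hkB' (hφ0' i.1) hr hrε i.2 (hpos i.1 i.2) (hrange i)
  choose Hd hHd ρ hρ hHm using hmatch
  have hid : ∀ j : ι, ∀ x ∉ V j, Hd j x = x := fun j x hx => (hHd j).apply_eq_self hx
  -- the sphere diffeomorphism
  haveI : Fintype ι := Fintype.ofFinite ι
  set L : List ι := (Finset.univ : Finset ι).toList with hL
  have hLnd : L.Nodup := Finset.nodup_toList _
  have hLmem : ∀ i : ι, i ∈ L := fun i => Finset.mem_toList.2 (Finset.mem_univ i)
  set F := Diffeomorph.invProd Hd L with hF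
  have hF_apply : ∀ (i : ι) {p : Metric.sphere (0 : E3) 1}, p ∈ V i → F p = (Hd i).symm p := fun i p hp => by
    rw [hF, Diffeomorph.invProd_apply_of_mem Hd V hid hVdisj L hLnd hp, if_pos (hLmem i)]
  refine ⟨bf, φ₀.trans F, ?_⟩
  -- the width `δ₀`: for every end, `‖y‖ < δ` gives `‖shrink⁻¹ y‖ ≤ ρ i` and `‖y‖ < r`
  have hev3 : ∀ i : ι, ∀ᶠ y in 𝓝 (0 : E2), ‖(BasinPair.SaddleData.shrinkB r).symm y‖ ≤ ρ i ∧ ‖y‖ < r := by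
    intro i
    have hcs : ContinuousAt (BasinPair.SaddleData.shrinkB r).symm (0 : E2) :=
      (BasinPair.SaddleData.contDiffAt_shrinkB_symm (r := r) (z := 0) (by rw [norm_zero]; exact hr)).continuousAt
    have h1 : ∀ᶠ y in 𝓝 (0 : E2), ‖(BasinPair.SaddleData.shrinkB r).symm y‖ < ρ i := by
      have h := (continuous_norm.continuousAt.comp hcs).eventually (eventually_lt_nhds (a := ‖(BasinPair.SaddleData.shrinkB r).symm 0‖)
        (b := ρ i) (by
          have h0 : (BasinPair.SaddleData.shrinkB r).symm (0 : E2) = 0 := by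
            conv_lhs => rw [← BasinPair.SaddleData.shrinkB_zero r]
            exact BasinPair.SaddleData.shrinkB_symm_apply r 0
          rw [h0, norm_zero]; exact hρ i))
      exact h
    have h2 : ∀ᶠ y : E2 in 𝓝 0, ‖y‖ < r :=
      (isOpen_lt continuous_norm continuous_const).mem_nhds (by show ‖(0 : E2)‖ < r; rw [norm_zero]; exact hr)
    filter_upwards [h1, h2] with y hy1 hy2
    exact ⟨hy1.le, hy2⟩
  obtain ⟨δ, hδ0, hδ⟩ := Metric.eventually_nhds_iff.1 (eventually_all.2 hev3)
  refine ⟨min (δ ^ 2) (Q.QA.ε ^ 2), lt_min (by positivity) Q.QA.sq_pos, min_le_right _ _, ?_⟩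
  -- the germ condition
  intro s b y hy
  have hy2 : ‖y‖ ^ 2 < δ ^ 2 := hy.trans_le (min_le_left _ _)
  have hyδ : ‖y‖ < δ := lt_of_pow_lt_pow_left₀ 2 hδ0.le hy2
  obtain ⟨hρy, hyr⟩ := hδ (y := y) (by rw [dist_zero_right]; exact hyδ) (s, b)
  set y' : E2 := (BasinPair.SaddleData.shrinkB r).symm y with hy'
  have hyy' : BasinPair.SaddleData.shrinkB r y' = y := BasinPair.SaddleData.shrinkB_apply_symm hr hyr
  have hm := hHm (s, b) y' hρy
  have hueA : Q'.QA.ue r s b y' = unitVec (Q'.QA.entDir s b y) := by rw [BasinPair.SaddleData.ue_apply, hyy']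
  have hueB : Q'.QB.ue r (Q'.σ s) b y' = unitVec (Q'.QB.entDir (Q'.σ s) b y) := by rw [BasinPair.SaddleData.ue_apply, hyy']
  have hq : Q'.QB.ue r (Q'.σ s) b y' ∈ V (s, b) := hrange (s, b) ⟨y', rfl⟩
  have hHq : Hd (s, b) (Q'.QB.ue r (Q'.σ s) b y') ∈ V (s, b) := Diffeomorph.apply_mem_of_forall (hid (s, b)) hq
  show ((F (φ₀ (unitVec (Q'.QA.entDir s b y))) : Metric.sphere (0 : E3) 1) : E3) = C.A.rad⁻¹ • Q'.QB.entDir (Q'.σ s) b y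
  rw [← hueA, ← hm, hF_apply (s, b) hHq, Diffeomorph.symm_apply_apply, hueB]
  have hyε : ‖y‖ ^ 2 < Q'.QB.ε ^ 2 := by
    have h := hy.trans_le (min_le_right _ _)
    have hεe : Q'.QB.ε = Q.QA.ε := Q.ε_eq
    rw [hεe]; exact h
  have hn : ‖Q'.QB.entDir (Q'.σ s) b y‖ = C.B.rad := Q'.QB.norm_entDir (hkB' _) hyε
  have hne : Q'.QB.entDir (Q'.σ s) b y ≠ 0 := by rw [← norm_ne_zero_iff, hn]; exact C.B.rad_pos.ne'
  rw [coe_unitVec hne, hn, C.rad_eq]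

include hkA hkB h₀ hc in
/-- **Structure conjugacy of two one-level Morse data on an oriented compact `3`-manifold with
boundary**: a diffeomorphism of `∂W` which extends to a diffeomorphism of `W` and maps the trace
of each saddle `s` of the first datum onto the trace of `σ s` of the second. [cite: MilnorHCobordism1965, Thm. 3.4, Def. 3.9, proof of Thm. 3.12/3.13] [cite: HirschDT1976, Ch. 4 §4; Ch. 8 §3, Thm. 3.1] -/
theorem diffeoExtends_of_orientation [Nonempty (BoundaryManifold.boundaryData 2 W).carrier] (o : SmoothOrientation (𝓡∂ (2 + 1)) W) :
    ∃ G : (𝓡∂ (2 + 1)).boundary W ≃ₘ⟮𝓡 2, 𝓡 2⟯ (𝓡∂ (2 + 1)).boundary W,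
      (BoundaryManifold.boundaryData 2 W).DiffeoExtends G ∧ ∀ s y, G y ∈ C.B.traceOf (Q.σ s) ↔ y ∈ C.A.traceOf s := by
  obtain ⟨bf, φ, δ₀, hδ₀, hδ₀ε, hG⟩ := Q.exists_germCond hkA hkB h₀ hc o
  have hkB' : ∀ s', ((Q.twistQB bf).QB.DA s').k = 1 := fun s' => hkB s'
  exact (Q.twistQB bf).diffeoExtends_of_sphereDiffeo hkA hkB' h₀ hc φ hG hδ₀ hδ₀ε

end BasinCouple.SaddleData

end Literature.Topology.FourManifolds
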